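import Summits.CriticalPhenomena.PercolationContinuityZ3.Theorems.Transplant.SkelPhiCorridorKitsF
import Summits.CriticalPhenomena.PercolationContinuityZ3.Theorems.Transplant.SkelPhiCorridorStepsFHab
import Summits.CriticalPhenomena.PercolationContinuityZ3.Theorems.Transplant.SkelPhiCorridorChainF
import HarnessLib

/-!
# N2 (frames-only node `SamePDropOfSkeletonFrm₁`, OPEN), (R)/(C) junction ((R-26)): **THE FORCED-KIT CLAUSES OF EVERY STEP OF A SCHEDULE WITH PARKING
# READ IN ONE x-FRAME THROUGH A PLAIN WINDOW** — `Skelφ.hkits_schedF`: the plain-window (`planarWindowWin (lip_runX …) w₀ R`, graph `winGraph G w₀ R`)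
# twin of `hkits_schedFHab` (SkelPhiCorridorStepsFHab): the `hkits` hypothesis of `WinChainData.chainF_of_seg` for ANY `S : ChainPlanar.ScheduleNP`,
# from the kit rows, the slot rows, the rim cover and the per-step per-centre PARKED-OR-ROUTED input (plain law) — for the ROOT LEGS of (R-26),
# whose chains live in ball windows `winGraph G c Rπ` (p3-g15's packaging `hchainr`).  No habitat, no padded contacts.
builds on p205010 (kernel theorem, internal audit signed; external expert review pending) — nothing in this file uses p205010; nothing here is a
claim about the open node `SamePDropOfSkeletonFrm₁`.
Lane `prim-bschramm`, seat `prim-bschramm-p5` (gen 15; (C) lineage, typed for the (R) column of (R-26)); helper file (`--supports stmt-CriticalPhenomena-4575 --as helper`).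
* `stepLF_toFrame_win_eq`, `stepDF_toFrame_win_eq`, `coreEF_toFrame_win_eq` (the chain's sets at a `ScheduleNP` frame through a plain window, `rfl`);
* **`hkits_schedF`**.
[cite: KozmaNitzan2024, §4 Lemma 10 Steps III–V (pp. 19–22), Lemma 11 (pp. 22–23), Lemma 12 (pp. 23–25)] [cite: MartineauTassion2017, §4.3 Lemma 4.2]
-/

noncomputable section

open scoped Classical

namespace Summit.CriticalPhenomena.PercolationContinuityZ3.Theorems.Transplant

namespace Skelφ

open MeasureTheory
open Literature.Probability.Percolation Literature.Probability.LatticeModels SimpleGraph KNLevels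
open Literature.Barriers.CriticalPhenomena (graphBall graphBall_finite mem_graphBall_self graphBall_mono)
open Skel (winGraph winGraph_adj winGraph_le winGraphIn winGraphIn_le KitGeom)
open Literature.Probability.Percolation.KozmaNitzan.Cells (oth oth_ne eq_oth_of_ne oth_oth)
open SkelI (tanOff tanTgt tanTgt_mem)
open ChainPlanar ChainPara

variable {V : Type} [DecidableEq V] {G : SimpleGraph V} [G.LocallyFinite] {φ : V → Site 2}

/-! ## §1 The chain's sets at a schedule frame through a plain window -/

/-- The chain's level data at a `ScheduleNP` frame through a plain window is `winLData` over the frame's corners. [folklore] -/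
theorem stepLF_toFrame_win_eq {ψ : V → Site 2} (hlip : Lip G ψ) (w₀ : V) (R : ℕ) (Pd : WinChainData V) (S : ScheduleNP) (k : ℕ) :
    Pd.stepLF (planarWindowWin hlip w₀ R) S.toFrame k = winLData G ψ w₀ R (S.lo k) (S.hi k) Pd.o Pd.Sfin := rfl

/-- The chain's step region at a `ScheduleNP` frame through a plain window. [folklore] -/
theorem stepDF_toFrame_win_eq {ψ : V → Site 2} (hlip : Lip G ψ) (w₀ : V) (R : ℕ) (S : ScheduleNP) (k : ℕ) :
    (planarWindowWin hlip w₀ R).stepDF S.toFrame k = Win G ψ w₀ (S.region k) R := rfl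

/-- The chain's enlarged target at a `ScheduleNP` frame through a plain window. [folklore] -/
theorem coreEF_toFrame_win_eq {ψ : V → Site 2} (hlip : Lip G ψ) (w₀ : V) (R : ℕ) (Pd : WinChainData V) (S : ScheduleNP) (k : ℕ) :
    Pd.coreEF (planarWindowWin hlip w₀ R) S.toFrame k = Win G ψ w₀ (ScheduleNP.core S (k + 1)) R ∪ Pd.Rim k := rfl

/-! ## §2 The per-step clauses of a schedule with parking in one frame through a plain window -/

/-- **THE FORCED-KIT CLAUSES OF EVERY STEP OF A SCHEDULE WITH PARKING, ONE x-FRAME, PLAIN WINDOW** — the `hkits` of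
`WinChainData.chainF_of_seg` at `planarWindowWin (lip_runX …) w₀ R` / `S.toFrame`: from the kit rows, the slot rows `tanOff ≤ j₀`, `j₁ ≤ R′`,
`j₁ + reach ≤ R′`, the rim cover `hcover`, the count rows, and the per-step per-centre PARKED-OR-ROUTED input `hrouteS` (under the law `W'`).
[cite: KozmaNitzan2024, §4 Lemma 10 (pp. 17–22), Lemma 12 (pp. 23–25)] [this work] -/
theorem hkits_schedF [Countable V] (hlipφ : Lip G φ) (hstep : Steps G φ) {Δ : ℕ} (hΔ : ∀ v, G.degree v ≤ Δ) {q : unitInterval} {δ : ℝ}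
    (hδ : 0 < δ)
    -- the frame, the schedule, the window
    {nL : ℕ} (hnL : 1 ≤ nL) (c₀ : V) (hL : ℤ) {σ : ℤ} (hσ : σ = 1 ∨ σ = -1) {kq : ℕ} (hκL : hL.natAbs ≤ kq * nL)
    (S : ScheduleNP) {w₀ : V} {R r : ℕ}
    -- kit constants
    (P : ApronPrm) {Mz Rs KCmax rs cS cU : ℕ} (hPN : kq + 3 ≤ P.N) (hA : P.A = (Mz + 1 : ℕ) * (shearUnit nL hL : ℤ) + 1)
    (hdD : P.d + 2 ≤ shellD P) (hDρ : Rs + 1 ≤ shellD P) (hKCmax : (shellD P + Mz + 1) * (kq + 1) ≤ KCmax)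
    (hT : (shellD P : ℤ) + KCmax + Rs ≤ tanOff P.ℓs P.M)
    (hr₀ : P.N * (tanOff P.ℓs P.M + 2) + P.N * P.d + (KCmax + Rs) ≤ P.r₀) (hR : P.r₀ ≤ R)
    (hrs : 1 + (P.N * (tanOff P.ℓs P.M + 2) + P.N * P.d + (KCmax + Rs)) ≤ rs)
    (hcS : (P.N + 1) * (tanOff P.ℓs P.M + 1) + (P.N + 1) * P.d + (KCmax + 1) + cU ≤ cS)
    (hreach : r + (P.N * (tanOff P.ℓs P.M + 1) + P.N * P.d + KCmax) ≤ P.r₀)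
    -- the short region and the zone datum
    (Rg : V → Finset V) (hRg : ∀ c, ∀ u ∈ Rg c, u ∈ graphBall G c Rs) (hRgcard : ∀ c, (Rg c).card ≤ cU) (hcU1 : 1 ≤ cU)
    (Λc : V → ℕ → Finset V) (kz : ℕ) (hΛRg : ∀ c, Λc c kz ⊆ Rg c) (hzconn : ∀ c, ∀ s ∈ Λc c kz, PathIn G (↑(Λc c kz) : Set V) c s)
    (hcz : ∀ c, c ∈ Λc c kz)
    {types : Finset V} (hfr : Frames G φ types) (hκ : CylConn G φ types) {Rk : ℕ} (hkz : 1 ≤ kz)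
    (hRk : cylRadMax G φ types kz (2 * KCmax) ≤ Rk) (hΛcyl : ∀ c, cylBallFin G φ c kz Rk ⊆ Λc c kz)
    -- the chain data and its slot rows
    (Pd : WinChainData V) (hj0 : tanOff P.ℓs P.M ≤ Pd.j₀) (hj1R : Pd.j₁ ≤ S.R')
    (hE : Pd.j₁ + (P.N * (tanOff P.ℓs P.M + 1) + P.N * P.d + KCmax) ≤ S.R')
    (kk : ℕ) (hN : kk * (Δ + 1) ^ (2 * rs) ≤ Pd.N) (hk : (1 - (q : ℝ) ^ (1 + Δ * cS + cS * cU)) ^ kk ≤ δ)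
    -- the rim of every region window is covered by `Rim`
    (hcover : ∀ k ≤ S.N, ∀ v ∈ Win G (runX φ c₀ nL hL σ) w₀ (S.region k) R, v ∉ graphBall G w₀ (R - P.r₀) → v ∈ Pd.Rim k)
    -- THE PER-STEP PER-CENTRE INPUT (under the law `W'`; built by the caller from a sub-box law on the region windows)
    {W' : Sym2 V → unitInterval}
    (hrouteS : ∀ k ≤ S.N, ∀ c : V,
      runX φ c₀ nL hL σ c ∈ Finset.Icc (S.lo k - ((S.R' : ℕ) : Site 2)) (S.hi k + ((S.R' : ℕ) : Site 2)) → c ∈ graphBall G w₀ (R - r) →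
      c ∈ Win G (runX φ c₀ nL hL σ) w₀ (ScheduleNP.core S (k + 1)) R ∪ Pd.Rim k ∨
      ∃ Qt Ft : Finset V, Ft ⊆ Win G (runX φ c₀ nL hL σ) w₀ (ScheduleNP.core S (k + 1)) R ∪ Pd.Rim k ∧
        Qt ⊆ Win G (runX φ c₀ nL hL σ) w₀ (S.region k) R ∧ 1 - δ ^ 3 ≤ (prodBernoulli W').real (linkIn (↑Qt : Set V) (Λc c kz) Ft)) :
    ∀ k ≤ S.N, ∀ j ∈ Finset.Icc Pd.j₀ Pd.j₁, ∃ (σ' : SData V) (Sz : Finset V),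
      SHyp (Pd.stepLF (planarWindowWin (lip_runX hlipφ hσ hnL c₀ hL) w₀ R) S.toFrame k) j σ' ∧ σ'.N ≤ Pd.N ∧
      (1 - (q : ℝ) ^ σ'.sB) ^ σ'.k ≤ δ ∧ Sz ⊆ (planarWindowWin (lip_runX hlipφ hσ hnL c₀ hL) w₀ R).stepDF S.toFrame k ∧
      (∀ x ∈ σ'.K, σ'.face x ⊆ Sz) ∧
      RelayClause (Pd.stepLF (planarWindowWin (lip_runX hlipφ hσ hnL c₀ hL) w₀ R) S.toFrame k) W' j σ' Sz
        (Pd.coreEF (planarWindowWin (lip_runX hlipφ hσ hnL c₀ hL) w₀ R) S.toFrame k)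
        ((planarWindowWin (lip_runX hlipφ hσ hnL c₀ hL) w₀ R).stepDF S.toFrame k) δ := by
  intro k hkN j hj
  set ψ := runX φ c₀ nL hL σ with hψ
  obtain ⟨hj₀, hj₁⟩ := Finset.mem_Icc.1 hj
  have hjR : j ≤ S.R' := hj₁.trans hj1R
  -- the planar level box lies in the region
  have hlev : Finset.Icc (S.lo k - ((j : ℕ) : Site 2)) (S.hi k + ((j : ℕ) : Site 2)) ⊆ S.region k := S.level_subset_region hkN hjR
  have hXD : winLevel G ψ w₀ R (S.lo k) (S.hi k) j ⊆ Win G ψ w₀ (S.region k) R := Win_mono G _ hlev le_rfl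
  -- the rim: far level vertices are covered
  have hfarT : ∀ v ∈ winLevel G ψ w₀ R (S.lo k) (S.hi k) j, v ∉ graphBall G w₀ (R - P.r₀) →
      v ∈ Win G ψ w₀ (ScheduleNP.core S (k + 1)) R ∪ Pd.Rim k := fun v hv hfar =>
    Finset.mem_union_right _ (hcover k hkN v (hXD hv) hfar)
  -- the level widths and the reach row
  obtain ⟨hwide, hdw, hDw⟩ := level_widthsNP S (k := k) (by omega) P (KCmax := KCmax) (Rs := Rs) (j := j) (hj0.trans hj₀) hdD hT
  have hEj : j + (P.N * (tanOff P.ℓs P.M + 1) + P.N * P.d + KCmax) ≤ S.R' := by omega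
  -- the clause of the level, from the per-centre input
  rw [stepLF_toFrame_win_eq, stepDF_toFrame_win_eq, coreEF_toFrame_win_eq]
  exact hkits_levelF hlipφ hstep hΔ hδ hnL c₀ hL hσ hκL P hPN hA hdD hDρ hKCmax hwide hdw hDw hT hr₀ hR hrs hcS hEj hreach
    Rg hRg hRgcard hcU1 Λc kz hΛRg hzconn hcz hfr hκ hkz hRk hΛcyl kk Pd.o Pd.Sfin hXD hfarT hN hk (hrouteS k hkN)

end Skelφ

end Summit.CriticalPhenomena.PercolationContinuityZ3.Theorems.Transplant

end
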